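import Summits.QuantumFields.QCD.Theses.NestedDissectionSea

/-!
# Sketch — crux-ideate round 1, ideator 1, crux `RobustYangMillsRG` (stmt-QuantumFields-14958)

First lemmas of the two idea cards of this seat:

* `schwarz_flattening` (card `schwarz-flattening`, PROVED): an activity that is analytic and bounded
  by `M X` on the g-UNIFORM small-field domain `smallFieldDomain ρ b r ε X` is `2 M_X / r`-Lipschitz in
  the (Frobenius-sup) distance of the link variables around every real `ε`-small configuration —
  one-variable Schwarz lemma on the complex disc through the two configurations.  Consequence used by
  the card: on typical block fields (`‖ρ(V_e) − 1‖ ≲ g(ℓ₀)` in a local gauge) every admissible O(1)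
  remainder `W` of the format is, up to a constant, COUPLING-RELATIVELY sup-small, `η_eff ≲ B₀ g/r`
  (and `≲ B₀ g²/r²` for the centred quadratic-free part), i.e. the RG-level crux is a D1-level
  sup-small cone around the perfect action.
* `MontelClosedFormat` (card `block-lattice-compactness`, a `Prop`, provable from the tree's SCV
  Cauchy estimates + Arzelà–Ascoli): the analytic format bound `HasAnalyticNormLE ρ D κ B` on a fixed
  block torus is CLOSED under pointwise limits of the activities — the normal-family half of the
  compactification of the format at fixed block spacing.
-/

noncomputable section

open MeasureTheory Filter Topology Metric Set
open scoped Matrix.Norms.Frobenius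
open Literature.MathematicalPhysics.QuantumLattice Literature.MathematicalPhysics.QuantumFieldTheory

namespace Summit.QuantumFields.QCD.Cruxes.RobustYangMillsRG.Ideator1

variable {d L N : ℕ} [NeZero L] {G : Type*} [Group G] [MeasurableSpace G] {b : ℕ}

/-- The `r`-ball around a real `ε`-small configuration lies in the small-field domain of `X`. -/
theorem ball_subset_smallFieldDomain (ρ : G →* Matrix (Fin N) (Fin N) ℂ) {r ε : ℝ}
    {X : Finset (Site d L)} {U : GaugeConfig d L G}
    (hU : ∀ p ∈ polymerPlaquettes b X,
      (N : ℝ) - (ρ (plaquetteHolonomy U p.1 p.2.1.1 p.2.1.2)).trace.re ≤ ε) :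
    ball (complexify ρ U) r ⊆ smallFieldDomain ρ b r ε X := by
  unfold smallFieldDomain
  exact Set.subset_biUnion_of_mem (u := fun V : GaugeConfig d L G => ball (complexify ρ V) r) hU

/-- **Schwarz flattening.** If the activities of `W` are analytic on the g-uniform small-field
domains with bounds `M`, then around every real `ε`-small configuration `U` each activity is
`2 M_X / r`-Lipschitz in the link variables: for `U'` with `dist (ρ ∘ U') (ρ ∘ U) < r`,
`|W_X(U') − W_X(U)| ≤ (2 M_X / r) · dist (ρ ∘ U') (ρ ∘ U)`.  (Schwarz lemma for the bounded
holomorphic function `z ↦ F_X(c + (z/δ)(c' − c))` on the disc `|z| < r`.) -/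
theorem schwarz_flattening (ρ : G →* Matrix (Fin N) (Fin N) ℂ)
    (W : QuasiLocalGaugePerturbation d L G b)
    {r ε : ℝ} (hr : 0 < r) {M : Finset (Site d L) → ℝ}
    (hW : W.IsAnalyticOn ρ (smallFieldDomain ρ b r ε) M)
    {X : Finset (Site d L)} (hX : X ∈ polymers (d := d) (L := L) b) {U U' : GaugeConfig d L G}
    (hU : ∀ p ∈ polymerPlaquettes b X,
      (N : ℝ) - (ρ (plaquetteHolonomy U p.1 p.2.1.1 p.2.1.2)).trace.re ≤ ε)
    (hδ : dist (complexify ρ U') (complexify ρ U) < r) :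
    |W.act X U' - W.act X U| ≤ 2 * M X / r * dist (complexify ρ U') (complexify ρ U) := by
  obtain ⟨F, hFd, hFW, hFM⟩ := hW X hX
  -- notation: `c = ρ ∘ U`, `c' = ρ ∘ U'`, `δ = dist c' c`
  have hball : ball (complexify ρ U) r ⊆ smallFieldDomain ρ b r ε X :=
    ball_subset_smallFieldDomain ρ hU
  have hcD : complexify ρ U ∈ smallFieldDomain ρ b r ε X := hball (mem_ball_self hr)
  have hc'D : complexify ρ U' ∈ smallFieldDomain ρ b r ε X := hball (mem_ball.2 hδ)
  -- the real activities are the restrictions of `F`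
  have hWU : (W.act X U : ℂ) = F (complexify ρ U) := (hFW U hcD).symm
  have hWU' : (W.act X U' : ℂ) = F (complexify ρ U') := (hFW U' hc'D).symm
  have hdiff : |W.act X U' - W.act X U| = dist (F (complexify ρ U')) (F (complexify ρ U)) := by
    rw [dist_eq_norm, ← hWU, ← hWU', ← Complex.ofReal_sub, Complex.norm_real, Real.norm_eq_abs]
  rw [hdiff]
  have hM0 : 0 ≤ M X := (norm_nonneg _).trans (hFM _ hcD)
  rcases eq_or_lt_of_le (dist_nonneg : 0 ≤ dist (complexify ρ U') (complexify ρ U)) with hδ0 | hδpos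
  · -- degenerate case `c' = c`
    have hcc : complexify ρ U' = complexify ρ U := dist_eq_zero.1 hδ0.symm
    rw [hcc, dist_self, dist_self, mul_zero]
  · -- the complex disc through `c` and `c'`: `g z = c + (z/δ) (c' - c)`
    have hne : ((dist (complexify ρ U') (complexify ρ U) : ℝ) : ℂ) ≠ 0 := by
      exact_mod_cast hδpos.ne'
    let g : ℂ → ComplexGaugeConfig d L N := fun z =>
      complexify ρ U + (z / (dist (complexify ρ U') (complexify ρ U) : ℂ)) •
        (complexify ρ U' - complexify ρ U)
    have hg0 : g 0 = complexify ρ U := by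
      show complexify ρ U + ((0 : ℂ) / _) • _ = _
      rw [zero_div, zero_smul, add_zero]
    have hgδ : g (dist (complexify ρ U') (complexify ρ U) : ℂ) = complexify ρ U' := by
      show complexify ρ U + (_ / _) • _ = _
      rw [div_self hne, one_smul, add_sub_cancel]
    have hgdist : ∀ z : ℂ, dist (g z) (complexify ρ U) = ‖z‖ := by
      intro z
      have hcc : ‖complexify ρ U' - complexify ρ U‖ = dist (complexify ρ U') (complexify ρ U) := by
        rw [← dist_eq_norm]
      show dist (complexify ρ U + (z / (dist (complexify ρ U') (complexify ρ U) : ℂ)) •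
        (complexify ρ U' - complexify ρ U)) (complexify ρ U) = ‖z‖
      rw [dist_eq_norm, add_sub_cancel_left, norm_smul, norm_div, Complex.norm_real, Real.norm_eq_abs,
        abs_of_pos hδpos, hcc, div_mul_cancel₀ _ hδpos.ne']
    have hgmaps : MapsTo g (ball (0 : ℂ) r) (smallFieldDomain ρ b r ε X) := by
      intro z hz
      apply hball
      rw [mem_ball, hgdist z]
      simpa using hz
    have hgdiffble : Differentiable ℂ g :=
      ((differentiable_id.div_const _).smul_const _).const_add _
    have hfd : DifferentiableOn ℂ (F ∘ g) (ball (0 : ℂ) r) :=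
      hFd.comp hgdiffble.differentiableOn hgmaps
    have hf0 : (F ∘ g) 0 = F (complexify ρ U) := by
      show F (g 0) = _; rw [hg0]
    have hfδ : (F ∘ g) (dist (complexify ρ U') (complexify ρ U) : ℂ) = F (complexify ρ U') := by
      show F (g _) = _; rw [hgδ]
    -- Schwarz lemma with target radius `2 M X`
    have hmaps : MapsTo (F ∘ g) (ball (0 : ℂ) r) (closedBall ((F ∘ g) 0) (2 * M X)) := by
      intro z hz
      rw [mem_closedBall, hf0]
      have h1 : ‖F (g z)‖ ≤ M X := hFM _ (hgmaps hz)
      have h2 : ‖F (complexify ρ U)‖ ≤ M X := hFM _ hcD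
      calc dist ((F ∘ g) z) (F (complexify ρ U)) = ‖F (g z) - F (complexify ρ U)‖ := by
            rw [dist_eq_norm]; rfl
        _ ≤ ‖F (g z)‖ + ‖F (complexify ρ U)‖ := norm_sub_le _ _
        _ ≤ M X + M X := add_le_add h1 h2
        _ = 2 * M X := by ring
    have hzδ : (dist (complexify ρ U') (complexify ρ U) : ℂ) ∈ ball (0 : ℂ) r := by
      rw [mem_ball, dist_zero_right, Complex.norm_real, Real.norm_eq_abs, abs_of_pos hδpos]
      exact hδ
    have key := Complex.dist_le_div_mul_dist_of_mapsTo_ball hfd hmaps hzδ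
    rw [hfδ, hf0, dist_zero_right, Complex.norm_real, Real.norm_eq_abs, abs_of_pos hδpos] at key
    exact key

/-- **Montel closure of the analytic format** (first lemma of card `block-lattice-compactness`, a
`Prop`): on a fixed block torus, if perturbations `W n` all satisfy the analytic weighted-norm bound
`HasAnalyticNormLE ρ D κ B` on OPEN domains `D X` and their activities converge pointwise to those of
`W`, then `W` satisfies the same bound (normal families: the extensions are locally bounded on each
`D X`, a subsequence converges locally uniformly to a holomorphic extension of the limit activity,
and the bounds pass to the limit by Fatou on the finite polymer sums). -/
def MontelClosedFormat (d L N : ℕ) [NeZero L] (G : Type*) [Group G] [MeasurableSpace G] (b : ℕ)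
    (ρ : G →* Matrix (Fin N) (Fin N) ℂ)
    (D : Finset (Site d L) → Set (ComplexGaugeConfig d L N)) (κ B : ℝ) : Prop :=
  (∀ X, IsOpen (D X)) →
  ∀ (Wseq : ℕ → QuasiLocalGaugePerturbation d L G b) (W : QuasiLocalGaugePerturbation d L G b),
    (∀ n, (Wseq n).HasAnalyticNormLE ρ D κ B) →
    (∀ X U, Tendsto (fun n => (Wseq n).act X U) atTop (𝓝 (W.act X U))) →
      W.HasAnalyticNormLE ρ D κ B

/-- **Uniform-from-pointwise by compactness** (the soft half of card `block-lattice-compactness`,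
a `Prop` over an abstract compact parameter space): if a real functional `θ` (the finite-size
mixing influence at the certified scale) is upper semicontinuous on a compact space and strictly
below the threshold `t` at every point, it is uniformly below a smaller threshold. Mathlib-provable
(`IsCompact.exists_isMaxOn` for usc functions / `UpperSemicontinuous`). -/
def UniformFromPointwise : Prop :=
  ∀ (K : Type) [TopologicalSpace K] [CompactSpace K] [Nonempty K] (θ : K → ℝ) (t : ℝ),
    UpperSemicontinuous θ → (∀ x, θ x < t) → ∃ t' < t, ∀ x, θ x ≤ t'

end Summit.QuantumFields.QCD.Cruxes.RobustYangMillsRG.Ideator1
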